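import Literature.NumberTheory.EllipticCurves.H1UnramifiedFinite
import Literature.NumberTheory.EllipticCurves.KummerCharacterCountProofs
import Mathlib.Topology.Instances.ZMod
import HarnessLib

/-!
# Counting unramified classes in `H¹(G_K, M)` by dévissage along a fixed submodule, and the
# characters `G_K → ℤ/2` unramified outside `S`

Quantitative companion of `H1UnramifiedFinite` (Silverman, *The Arithmetic of Elliptic Curves*,
2nd ed., Lemma X.4.3: `H¹(G_{K̄/K}, M; S)` is finite) for the special situation of a
**dévissage** `0 → N → M → Q → 0` of a discrete `G_K`-module in which `G_K` acts trivially on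
`N = ker π` and on `Q` (i.e. `π (σ • m) = π m`), and the inertia groups outside `S` act trivially
on `M`. This is the situation of `M = E[2]` for an elliptic curve with a rational `2`-torsion point
`P` (`N = ⟨P⟩`, `Q = E[2]/⟨P⟩`, both of order `≤ 2`; file `SelmerTwoTorsionBoundProofs`), and the
count proved here is the cohomological form of "descent via `2`-isogeny" (Silverman, X.§4,
Prop. 4.9 and Ex. X.4.8: `#S^{(φ)}(E/ℚ) ≤ #ℚ(S, 2)`):

* `Literature.NumberTheory.EllipticCurves.ncard_le_of_devissage` — for a set `C` of classes of
  `H¹(G_K, M)` unramified outside `S`: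
  `#C ≤ #X_S(Q) · #X_S(ker π)`, where `X_S(A)` is the set of continuous homomorphisms
  `G_K → A` unramified outside `S` (vanishing on every inertia group `I_𝔓`, `𝔓 ∣ v ∉ S`). Proof
  on continuous cocycles (`Literature.NumberTheory.GaloisRepresentations.ContinuousH1`): a cocycle
  `φ` with unramified class *vanishes* on the `I_𝔓` (it is `σ ↦ σa − a` there, and `I_𝔓` acts
  trivially), `π ∘ φ` is a homomorphism, and two cocycles with the same `π ∘ φ` differ by a
  homomorphism `G_K → ker π` (values in `ker π` are fixed by `G_K`); so
  `[φ] ↦ (π ∘ φ, φ − φ_{base point of the fibre})` is injective.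
* `…ncard_unramifiedChars_le_of_injective` / `…finite_unramifiedChars_of_injective` — `X_S(A)`
  embeds into `X_S(ℤ/2)` along an injective `A →+ ℤ/2`; `exists_injective_addMonoidHom_zmod_two`:
  every group of order `≤ 2` has one.
* `…finite_unramifiedChars_zmod` / `…ncard_unramifiedChars_zmod_le` — for `ζ_d ∈ K`, `X_S(ℤ/d)`
  is finite with **`#X_S(ℤ/d) ≤ #K(S, d)`** (Kummer theory: `finite_kummerUnramifiedHoms`,
  `ncard_kummerUnramifiedHoms_le`), hence `#X_S(ℤ/2) ≤ 2^{#S+1}` over `ℚ`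
  (`Rat.natCard_selmerGroup_two_le`).
* `…ncard_le_sq_of_devissage` — assembling: if `#Q ≤ 2` and `#ker π ≤ 2` then
  **`#C ≤ (#K(S, 2))²`**, and `…Rat.ncard_le_four_pow_of_devissage`: **`#C ≤ 4^{#S+1}`** over `ℚ`.

## References

* J. H. Silverman, *The Arithmetic of Elliptic Curves*, 2nd ed. (2009): X.§4, Lemma 4.3 (and its
  proof: inflation–restriction to trivial action, `Hom(G, M; S)`), Prop. 4.9 / Ex. 4.8 (descent via
  two-isogeny: the Selmer group of `φ` injects into `ℚ(S, 2)`), Prop. VIII.1.6.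
  [cite: SilvermanAEC2009, Lemma X.4.3 (proof)]
* J.-P. Serre, *Galois Cohomology*, I.§5 (nonabelian `H¹`, exact sequences in low degree).

## Mathlib / tree reuse

Tree: `contOneCocycles`, `oneCocycleClass(_surjective, _sub)`, `map_oneCocycleClass`
(`GaloisRepresentations.ContinuousH1`); `h1Unramified`, `mem_h1Unramified_iff`, `unramifiedKer`
(`SelmerUnramified`); `oneCocycleClass_mem_subgroupResKer_iff`, `discreteTopRep_ρ_apply`
(`H1UnramifiedFinite`); `finite_kummerUnramifiedHoms` (`KummerHomsFinite`);
`ncard_kummerUnramifiedHoms_le`, `Rat.natCard_selmerGroup_two_le` (`KummerCharacterCountProofs`);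
`Field.absoluteGaloisGroup.toAlgEquiv` (`AbsGaloisGroup`). Mathlib: `krullTopology_mem_nhds_one_iff`,
`Nat.card_le_card_of_injective`, `Set.ncard_le_ncard_of_injOn`, `Set.Finite.of_finite_image`.

## Design

No definitions: the character sets `X_S(A)` are written inline as
`{f : G_K → A | Continuous f ∧ (∀ σ τ, f (σ * τ) = f σ + f τ) ∧ ∀ v ∉ S, ∀ 𝔓 ∈ v.primesAbove,
∀ σ ∈ I_𝔓, f σ = 0}` (the tree's `unramifiedHoms U A S` for `U = G_K`, but as functions on
`G_K` itself rather than on the subgroup `⊤`). One universe `u` (`K M : Type u`, forced by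
continuous cohomology), `noncomputable section`, `open scoped Classical`.
-/

noncomputable section

open scoped Classical NumberField

open NumberField IsDedekindDomain Field Literature.NumberTheory.GaloisRepresentations

universe u

namespace Literature.NumberTheory.EllipticCurves

/-! ## Groups of order at most two embed in `ℤ/2` -/

/-- A finite abelian group with at most two elements admits an injective homomorphism to `ℤ/2ℤ`
(`x ↦ 0` if `x = 0`, `1` otherwise; there is at most one nonzero element, which then has order
`2`). [folklore] -/
theorem exists_injective_addMonoidHom_zmod_two {A : Type*} [AddCommGroup A] [Finite A]
    (h : Nat.card A ≤ 2) : ∃ j : A →+ ZMod 2, Function.Injective j := by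
  classical
  -- at most one nonzero element
  have huniq : ∀ x y : A, x ≠ 0 → y ≠ 0 → x = y := by
    intro x y hx hy
    by_contra hxy
    have h3 : ({0, x, y} : Set A).ncard = 3 := by
      have hA : (0 : A) ∉ ({x, y} : Set A) := by
        simp only [Set.mem_insert_iff, Set.mem_singleton_iff, not_or]
        exact ⟨fun h ↦ hx h.symm, fun h ↦ hy h.symm⟩
      rw [Set.ncard_insert_of_notMem hA, Set.ncard_pair hxy]
    have := Set.ncard_le_card ({0, x, y} : Set A)
    omega
  have hdouble : ∀ x : A, x + x = 0 := by
    intro x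
    by_cases hx : x = 0
    · rw [hx, add_zero]
    by_contra h2
    exact hx (by simpa using huniq (x + x) x h2 hx)
  refine ⟨{ toFun := fun x ↦ if x = 0 then 0 else 1
            map_zero' := by simp
            map_add' := fun x y ↦ ?_ }, fun x y hxy ↦ ?_⟩
  · by_cases hx : x = 0
    · simp [hx]
    by_cases hy : y = 0
    · simp [hy]
    have hxy : x = y := huniq x y hx hy
    subst hxy
    rw [if_pos (hdouble x), if_neg hx]
    decide
  · simp only [AddMonoidHom.coe_mk, ZeroHom.coe_mk] at hxy
    by_cases hx : x = 0 <;> by_cases hy : y = 0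
    · rw [hx, hy]
    · simp [hx, hy] at hxy
    · simp [hx, hy] at hxy
    · exact huniq x y hx hy

/-! ## Characters unramified outside `S` -/

section Chars

variable {K : Type u} [Field K]

/-- **Characters with values in a subgroup of `ℤ/2`.** If `j : A →+ ℤ/2` is injective, composition
with `j` injects the continuous homomorphisms `G_K → A` unramified outside `S` into those with
values in `ℤ/2`; in particular the former are finite when the latter are. [folklore] -/
theorem finite_unramifiedChars_of_injective {A : Type*} [AddCommGroup A] [TopologicalSpace A]
    [DiscreteTopology A] (j : A →+ ZMod 2) (hj : Function.Injective j)
    (S : Set (HeightOneSpectrum (𝓞 K)))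
    (hfin : {f : absoluteGaloisGroup K → ZMod 2 | Continuous f ∧ (∀ σ τ, f (σ * τ) = f σ + f τ) ∧
      ∀ v ∉ S, ∀ 𝔓 ∈ v.primesAbove, ∀ σ ∈ 𝔓.inertia (absoluteGaloisGroup K), f σ = 0}.Finite) :
    {f : absoluteGaloisGroup K → A | Continuous f ∧ (∀ σ τ, f (σ * τ) = f σ + f τ) ∧
      ∀ v ∉ S, ∀ 𝔓 ∈ v.primesAbove, ∀ σ ∈ 𝔓.inertia (absoluteGaloisGroup K), f σ = 0}.Finite := by
  refine Set.Finite.of_finite_image (f := fun f σ ↦ j (f σ)) (hfin.subset ?_) ?_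
  · rintro _ ⟨f, hf, rfl⟩
    exact ⟨(continuous_of_discreteTopology (f := j)).comp hf.1,
      fun σ τ ↦ by beta_reduce; rw [hf.2.1, map_add],
      fun v hv 𝔓 h𝔓 σ hσ ↦ by beta_reduce; rw [hf.2.2 v hv 𝔓 h𝔓 σ hσ, map_zero]⟩
  · intro f _ g _ hfg
    funext σ
    exact hj (congr_fun hfg σ)

/-- Counted form of `finite_unramifiedChars_of_injective`: `#X_S(A) ≤ #X_S(ℤ/2)` along an
injective `j : A →+ ℤ/2`. [folklore] -/
theorem ncard_unramifiedChars_le_of_injective {A : Type*} [AddCommGroup A] [TopologicalSpace A]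
    [DiscreteTopology A] (j : A →+ ZMod 2) (hj : Function.Injective j)
    (S : Set (HeightOneSpectrum (𝓞 K)))
    (hfin : {f : absoluteGaloisGroup K → ZMod 2 | Continuous f ∧ (∀ σ τ, f (σ * τ) = f σ + f τ) ∧
      ∀ v ∉ S, ∀ 𝔓 ∈ v.primesAbove, ∀ σ ∈ 𝔓.inertia (absoluteGaloisGroup K), f σ = 0}.Finite) :
    {f : absoluteGaloisGroup K → A | Continuous f ∧ (∀ σ τ, f (σ * τ) = f σ + f τ) ∧
      ∀ v ∉ S, ∀ 𝔓 ∈ v.primesAbove, ∀ σ ∈ 𝔓.inertia (absoluteGaloisGroup K), f σ = 0}.ncard ≤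
    {f : absoluteGaloisGroup K → ZMod 2 | Continuous f ∧ (∀ σ τ, f (σ * τ) = f σ + f τ) ∧
      ∀ v ∉ S, ∀ 𝔓 ∈ v.primesAbove, ∀ σ ∈ 𝔓.inertia (absoluteGaloisGroup K), f σ = 0}.ncard := by
  refine Set.ncard_le_ncard_of_injOn (fun f σ ↦ j (f σ)) ?_ ?_ hfin
  · intro f hf
    exact ⟨(continuous_of_discreteTopology (f := j)).comp hf.1,
      fun σ τ ↦ by beta_reduce; rw [hf.2.1, map_add],
      fun v hv 𝔓 h𝔓 σ hσ ↦ by beta_reduce; rw [hf.2.2 v hv 𝔓 h𝔓 σ hσ, map_zero]⟩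
  · intro f _ g _ hfg
    funext σ
    exact hj (congr_fun hfg σ)

/-- The continuous homomorphisms `G_K → ℤ/d` unramified outside `S` satisfy the hypotheses of the
Kummer count (`finite_kummerUnramifiedHoms` / `ncard_kummerUnramifiedHoms_le` for `k = K`,
`Ω = K̄`): they are additive, vanish on `Gal(K̄/E)` for a finite `E/K` (the kernel is an open
subgroup, `krullTopology_mem_nhds_one_iff`), and vanish on the inertia groups of the primes of
`\bar ℤ_K` above the places outside `S`. [folklore] -/
theorem unramifiedChars_zmod_kummer {d : ℕ} (S : Set (HeightOneSpectrum (𝓞 K)))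
    (f : absoluteGaloisGroup K → ZMod d)
    (hf : f ∈ {f : absoluteGaloisGroup K → ZMod d | Continuous f ∧ (∀ σ τ, f (σ * τ) = f σ + f τ) ∧
      ∀ v ∉ S, ∀ 𝔓 ∈ v.primesAbove, ∀ σ ∈ 𝔓.inertia (absoluteGaloisGroup K), f σ = 0}) :
    (∀ σ τ : AlgebraicClosure K ≃ₐ[K] AlgebraicClosure K, f (σ * τ) = f σ + f τ) ∧
      (∃ E : IntermediateField K (AlgebraicClosure K), FiniteDimensional K E ∧
        ∀ σ ∈ E.fixingSubgroup, f σ = 0) ∧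
      ∀ w : HeightOneSpectrum (𝓞 K), w ∉ S →
        ∀ 𝔓 : Ideal (integralClosure (𝓞 K) (AlgebraicClosure K)), 𝔓.IsMaximal →
          𝔓.LiesOver w.asIdeal →
            ∀ σ ∈ 𝔓.inertia (AlgebraicClosure K ≃ₐ[K] AlgebraicClosure K), f σ = 0 := by
  obtain ⟨hcont, hadd, hunr⟩ := hf
  refine ⟨hadd, ?_, ?_⟩
  · -- the kernel is open, hence contains `Gal(K̄/E)` for a finite `E/K`
    have hf1 : f 1 = 0 := by
      have := hadd 1 1
      rw [mul_one] at this
      exact left_eq_add.mp this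
    have h0 : IsOpen (f ⁻¹' {0}) := (isOpen_discrete _).preimage hcont
    have hW : f ⁻¹' {0} ∈ nhds (1 : absoluteGaloisGroup K) := h0.mem_nhds hf1
    obtain ⟨E, hEfin, hEsub⟩ := (krullTopology_mem_nhds_one_iff K (AlgebraicClosure K) _).mp hW
    exact ⟨E, hEfin, fun σ hσ ↦ hEsub hσ⟩
  · intro w hw 𝔓 h𝔓max h𝔓over σ hσ
    refine hunr w hw 𝔓 ⟨h𝔓max.isPrime, h𝔓over⟩ σ ?_
    rw [Ideal.inertia, AddSubgroup.mem_inertia] at hσ ⊢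
    exact hσ

/-- **The characters `G_K → ℤ/d` unramified outside a finite `S` are finite in number** when
`ζ_d ∈ K` (Silverman, *AEC*, Prop. VIII.1.6, `Hom` form; `finite_kummerUnramifiedHoms` for
`k = K`, `Ω = K̄`). [cite: SilvermanAEC2009, Prop. VIII.1.6] -/
theorem finite_unramifiedChars_zmod [NumberField K] {d : ℕ} (hd : 0 < d) {ζ : K}
    (hζ : IsPrimitiveRoot ζ d)
    {S : Set (HeightOneSpectrum (𝓞 K))} (hS : S.Finite) :
    {f : absoluteGaloisGroup K → ZMod d | Continuous f ∧ (∀ σ τ, f (σ * τ) = f σ + f τ) ∧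
      ∀ v ∉ S, ∀ 𝔓 ∈ v.primesAbove, ∀ σ ∈ 𝔓.inertia (absoluteGaloisGroup K), f σ = 0}.Finite :=
  finite_kummerUnramifiedHoms (k := K) (Ω := AlgebraicClosure K) hd hζ hS _
    (fun f hf ↦ (unramifiedChars_zmod_kummer S f hf).1)
    (fun f hf ↦ (unramifiedChars_zmod_kummer S f hf).2.1)
    (fun f hf ↦ (unramifiedChars_zmod_kummer S f hf).2.2)

/-- **`#X_S(ℤ/d) ≤ #K(S, d)`** when `ζ_d ∈ K`: the continuous homomorphisms `G_K → ℤ/d`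
unramified outside a finite `S` are at most `#K(S, d)` in number (Kummer theory,
`ncard_kummerUnramifiedHoms_le`; Silverman, *AEC*, proof of Prop. VIII.1.6).
[cite: SilvermanAEC2009, Prop. VIII.1.6 (proof)] -/
theorem ncard_unramifiedChars_zmod_le [NumberField K] {d : ℕ} (hd : 0 < d) {ζ : K}
    (hζ : IsPrimitiveRoot ζ d)
    {S : Set (HeightOneSpectrum (𝓞 K))} (hS : S.Finite) :
    {f : absoluteGaloisGroup K → ZMod d | Continuous f ∧ (∀ σ τ, f (σ * τ) = f σ + f τ) ∧
      ∀ v ∉ S, ∀ 𝔓 ∈ v.primesAbove, ∀ σ ∈ 𝔓.inertia (absoluteGaloisGroup K), f σ = 0}.ncard ≤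
      Nat.card (IsDedekindDomain.selmerGroup (R := 𝓞 K) (K := K) (S := S) (n := d)) :=
  ncard_kummerUnramifiedHoms_le (k := K) (Ω := AlgebraicClosure K) hd hζ hS _
    (fun f hf ↦ (unramifiedChars_zmod_kummer S f hf).1)
    (fun f hf ↦ (unramifiedChars_zmod_kummer S f hf).2.1)
    (fun f hf ↦ (unramifiedChars_zmod_kummer S f hf).2.2)

/-- `−1` is a primitive square root of unity in a number field. [folklore] -/
theorem isPrimitiveRoot_neg_one_two [NumberField K] : IsPrimitiveRoot (-1 : K) 2 :=
  IsPrimitiveRoot.neg_one 0 (by norm_num)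

/-- **Quadratic characters unramified outside `S`**: over any number field `K`, the continuous
homomorphisms `G_K → ℤ/2` unramified outside a finite `S` form a finite set of size at most
`#K(S, 2)`. [cite: SilvermanAEC2009, Prop. VIII.1.6 (proof)] -/
theorem ncard_unramifiedChars_zmod_two_le [NumberField K] {S : Set (HeightOneSpectrum (𝓞 K))}
    (hS : S.Finite) :
    {f : absoluteGaloisGroup K → ZMod 2 | Continuous f ∧ (∀ σ τ, f (σ * τ) = f σ + f τ) ∧
      ∀ v ∉ S, ∀ 𝔓 ∈ v.primesAbove, ∀ σ ∈ 𝔓.inertia (absoluteGaloisGroup K), f σ = 0}.ncard ≤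
      Nat.card (IsDedekindDomain.selmerGroup (R := 𝓞 K) (K := K) (S := S) (n := 2)) :=
  ncard_unramifiedChars_zmod_le two_pos isPrimitiveRoot_neg_one_two hS

end Chars

/-! ## The dévissage count -/

section Devissage

variable {K : Type u} [Field K]
variable {M : Type u} [AddCommGroup M] [DistribMulAction (absoluteGaloisGroup K) M]
  [TopologicalSpace M] [DiscreteTopology M]

/-- **Counting unramified classes by dévissage.** Let `M` be a discrete `G_K`-module, `S` a set of
finite places such that every inertia group `I_𝔓` (`𝔓 ∣ v ∉ S`) acts trivially on `M`, and
`π : M →+ Q` a homomorphism with `π (σ • m) = π m` (trivial action on the image) whose kernel is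
fixed pointwise by `G_K`. Then a set `C` of classes of `H¹(G_K, M)` unramified outside `S` has at
most `#X_S(Q) · #X_S(ker π)` elements, `X_S(A)` denoting the continuous homomorphisms `G_K → A`
unramified outside `S` (assumed finite). Proof on continuous crossed homomorphisms: a cocycle
`φ` representing an unramified class vanishes on each `I_𝔓` (there `φ σ = σa − a = 0`); `π ∘ φ`
lies in `X_S(Q)`; if `π ∘ φ = π ∘ φ'` then `φ − φ'` takes values in `ker π ⊆ M^{G_K}` and so lies
in `X_S(ker π)`; hence `[φ] ↦ (π ∘ φ, φ − φ_b)`, `φ_b` the representative of a fixed class with the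
same `π ∘ φ`, is injective. This is the exact sequence
`Hom(G_K, N; S) → H¹(G_K, M; S) → Hom(G_K, Q; S)` (Serre, *Galois Cohomology*, I.§5; Silverman,
*AEC*, X.§4, proof of Lemma 4.3 and Prop. 4.9) used set-theoretically. [folklore] -/
theorem ncard_le_of_devissage (S : Set (HeightOneSpectrum (𝓞 K)))
    {Q : Type*} [AddCommGroup Q] [TopologicalSpace Q] [DiscreteTopology Q]
    (π : M →+ Q) (hπ : ∀ (σ : absoluteGaloisGroup K) (m : M), π (σ • m) = π m)
    (hfix : ∀ m : M, π m = 0 → ∀ σ : absoluteGaloisGroup K, σ • m = m)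
    (hI : ∀ v ∉ S, ∀ 𝔓 ∈ v.primesAbove, ∀ σ ∈ 𝔓.inertia (absoluteGaloisGroup K),
      ∀ m : M, σ • m = m)
    (C : Set (discreteH1 (absoluteGaloisGroup K) M)) (hC : C ⊆ h1Unramified M S)
    (hQfin : {f : absoluteGaloisGroup K → Q | Continuous f ∧ (∀ σ τ, f (σ * τ) = f σ + f τ) ∧
      ∀ v ∉ S, ∀ 𝔓 ∈ v.primesAbove, ∀ σ ∈ 𝔓.inertia (absoluteGaloisGroup K), f σ = 0}.Finite)
    (hNfin : {f : absoluteGaloisGroup K → π.ker | Continuous f ∧ (∀ σ τ, f (σ * τ) = f σ + f τ) ∧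
      ∀ v ∉ S, ∀ 𝔓 ∈ v.primesAbove, ∀ σ ∈ 𝔓.inertia (absoluteGaloisGroup K), f σ = 0}.Finite) :
    C.ncard ≤
      {f : absoluteGaloisGroup K → Q | Continuous f ∧ (∀ σ τ, f (σ * τ) = f σ + f τ) ∧
        ∀ v ∉ S, ∀ 𝔓 ∈ v.primesAbove, ∀ σ ∈ 𝔓.inertia (absoluteGaloisGroup K), f σ = 0}.ncard *
      {f : absoluteGaloisGroup K → π.ker | Continuous f ∧ (∀ σ τ, f (σ * τ) = f σ + f τ) ∧
        ∀ v ∉ S, ∀ 𝔓 ∈ v.primesAbove, ∀ σ ∈ 𝔓.inertia (absoluteGaloisGroup K), f σ = 0}.ncard := by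
  classical
  set XQ := {f : absoluteGaloisGroup K → Q | Continuous f ∧ (∀ σ τ, f (σ * τ) = f σ + f τ) ∧
      ∀ v ∉ S, ∀ 𝔓 ∈ v.primesAbove, ∀ σ ∈ 𝔓.inertia (absoluteGaloisGroup K), f σ = 0} with hXQ
  set XN := {f : absoluteGaloisGroup K → π.ker | Continuous f ∧ (∀ σ τ, f (σ * τ) = f σ + f τ) ∧
      ∀ v ∉ S, ∀ 𝔓 ∈ v.primesAbove, ∀ σ ∈ 𝔓.inertia (absoluteGaloisGroup K), f σ = 0} with hXN
  haveI : Finite XQ := hQfin.to_subtype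
  haveI : Finite XN := hNfin.to_subtype
  -- cocycle representatives
  have hrep : ∀ c : C, ∃ φ : contOneCocycles (discreteTopRep (absoluteGaloisGroup K) M),
      oneCocycleClass _ φ = (c : discreteH1 (absoluteGaloisGroup K) M) := fun c ↦
    oneCocycleClass_surjective _ _
  choose φ hφ using hrep
  -- they vanish on the inertia groups outside `S`
  have hvan : ∀ (c : C), ∀ v ∉ S, ∀ 𝔓 ∈ v.primesAbove,
      ∀ σ ∈ 𝔓.inertia (absoluteGaloisGroup K), (φ c).1 σ = 0 := by
    intro c v hv 𝔓 h𝔓 σ hσ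
    have hmem := mem_h1Unramified_iff.1 (hC c.2) v hv 𝔓 h𝔓
    rw [← hφ c] at hmem
    obtain ⟨a, ha⟩ := (oneCocycleClass_mem_subgroupResKer_iff _ (φ c)).1 hmem
    have ha' : (φ c).1 σ = σ • a - a := ha ⟨σ, hσ⟩
    rw [ha', hI v hv 𝔓 h𝔓 σ hσ a, sub_self]
  -- first coordinate: `π ∘ φ`
  let F₁ : C → (absoluteGaloisGroup K → Q) := fun c σ ↦ π ((φ c).1 σ)
  have hF₁ : ∀ c, F₁ c ∈ XQ := by
    intro c
    refine ⟨(continuous_of_discreteTopology (f := π)).comp (φ c).1.continuous, fun σ τ ↦ ?_,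
      fun v hv 𝔓 h𝔓 σ hσ ↦ ?_⟩
    · simp only [F₁]
      rw [(φ c).2 σ τ, map_add, discreteTopRep_ρ_apply, hπ]
    · simp only [F₁]
      rw [hvan c v hv 𝔓 h𝔓 σ hσ, map_zero]
  -- a base point in each fibre of `F₁`
  have hbase : ∀ g : Set.range F₁, ∃ c, F₁ c = g := fun g ↦ g.2
  choose base hbase using hbase
  have hker : ∀ (c : C) (σ : absoluteGaloisGroup K),
      π ((φ c).1 σ - (φ (base ⟨F₁ c, c, rfl⟩)).1 σ) = 0 := by
    intro c σ
    have h := congr_fun (hbase ⟨F₁ c, c, rfl⟩) σ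
    simp only [F₁] at h
    rw [map_sub, h, sub_self]
  -- second coordinate: `φ − φ_base`, valued in `ker π`
  let F₂ : C → (absoluteGaloisGroup K → π.ker) := fun c σ ↦
    ⟨(φ c).1 σ - (φ (base ⟨F₁ c, c, rfl⟩)).1 σ, (AddMonoidHom.mem_ker).2 (hker c σ)⟩
  have hF₂ : ∀ c, F₂ c ∈ XN := by
    intro c
    refine ⟨?_, fun σ τ ↦ ?_, fun v hv 𝔓 h𝔓 σ hσ ↦ ?_⟩
    · exact ((φ c).1.continuous.sub (φ (base ⟨F₁ c, c, rfl⟩)).1.continuous).subtype_mk _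
    · apply Subtype.ext
      simp only [F₂, AddSubgroup.coe_add]
      have hfixτ := hfix _ (hker c τ) σ
      rw [(φ c).2 σ τ, (φ (base ⟨F₁ c, c, rfl⟩)).2 σ τ, discreteTopRep_ρ_apply,
        discreteTopRep_ρ_apply, add_sub_add_comm, ← smul_sub, hfixτ]
    · apply Subtype.ext
      simp only [F₂, AddSubgroup.coe_zero]
      rw [hvan c v hv 𝔓 h𝔓 σ hσ, hvan (base ⟨F₁ c, c, rfl⟩) v hv 𝔓 h𝔓 σ hσ, sub_self]
  -- the injection
  have hinj : Function.Injective (fun c : C ↦ ((⟨F₁ c, hF₁ c⟩ : XQ), (⟨F₂ c, hF₂ c⟩ : XN))) := by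
    intro c c' h
    simp only [Prod.mk.injEq, Subtype.mk.injEq] at h
    obtain ⟨h1, h2⟩ := h
    have hb : base ⟨F₁ c, c, rfl⟩ = base ⟨F₁ c', c', rfl⟩ := by
      congr 1
      exact Subtype.ext h1
    have hφeq : φ c = φ c' := by
      apply Subtype.ext
      ext σ
      have h := congr_fun h2 σ
      simp only [F₂, Subtype.mk.injEq] at h
      rw [hb] at h
      exact sub_left_inj.mp h
    apply Subtype.ext
    rw [← hφ c, ← hφ c', hφeq]
  have hle := Nat.card_le_card_of_injective _ hinj
  rwa [Nat.card_prod, Nat.card_coe_set_eq, Nat.card_coe_set_eq, Nat.card_coe_set_eq] at hle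

/-- **`#C ≤ (#K(S, 2))²`** in the dévissage situation with both graded pieces of order `≤ 2`:
with `M`, `S`, `π`, `C` as in `ncard_le_of_devissage`, `S` finite, `#Q ≤ 2` and `#ker π ≤ 2`, the
unramified classes number at most `(#K(S, 2))²` (`X_S(Q)`, `X_S(ker π) ↪ X_S(ℤ/2)`, and
`#X_S(ℤ/2) ≤ #K(S, 2)` by Kummer theory). For `M = E[2]` with a rational `2`-torsion point this is
the classical bound behind descent via `2`-isogeny, Silverman, *AEC*, X.4.9. [cite: SilvermanAEC2009, Prop. X.4.9 (with Lemma X.4.3)] -/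
theorem ncard_le_sq_of_devissage [NumberField K] {S : Set (HeightOneSpectrum (𝓞 K))} (hS : S.Finite)
    {Q : Type*} [AddCommGroup Q] [TopologicalSpace Q] [DiscreteTopology Q] [Finite Q]
    (hQ : Nat.card Q ≤ 2) (π : M →+ Q) (hπ : ∀ (σ : absoluteGaloisGroup K) (m : M), π (σ • m) = π m)
    (hfix : ∀ m : M, π m = 0 → ∀ σ : absoluteGaloisGroup K, σ • m = m)
    [Finite π.ker] (hN : Nat.card π.ker ≤ 2)
    (hI : ∀ v ∉ S, ∀ 𝔓 ∈ v.primesAbove, ∀ σ ∈ 𝔓.inertia (absoluteGaloisGroup K),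
      ∀ m : M, σ • m = m)
    (C : Set (discreteH1 (absoluteGaloisGroup K) M)) (hC : C ⊆ h1Unramified M S) :
    C.ncard ≤ Nat.card (IsDedekindDomain.selmerGroup (R := 𝓞 K) (K := K) (S := S) (n := 2)) ^ 2 := by
  obtain ⟨jQ, hjQ⟩ := exists_injective_addMonoidHom_zmod_two hQ
  obtain ⟨jN, hjN⟩ := exists_injective_addMonoidHom_zmod_two hN
  have h2fin := finite_unramifiedChars_zmod (K := K) two_pos isPrimitiveRoot_neg_one_two hS
  have h2 := ncard_unramifiedChars_zmod_two_le (K := K) hS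
  have hQfin := finite_unramifiedChars_of_injective jQ hjQ S h2fin
  have hNfin := finite_unramifiedChars_of_injective jN hjN S h2fin
  have hQle := ncard_unramifiedChars_le_of_injective jQ hjQ S h2fin
  have hNle := ncard_unramifiedChars_le_of_injective jN hjN S h2fin
  calc C.ncard ≤ _ := ncard_le_of_devissage S π hπ hfix hI C hC hQfin hNfin
    _ ≤ Nat.card (IsDedekindDomain.selmerGroup (R := 𝓞 K) (K := K) (S := S) (n := 2)) *
          Nat.card (IsDedekindDomain.selmerGroup (R := 𝓞 K) (K := K) (S := S) (n := 2)) :=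
        Nat.mul_le_mul (hQle.trans h2) (hNle.trans h2)
    _ = _ := (sq _).symm

end Devissage

/-- **Over `ℚ`: `#C ≤ 4^{#S+1}`.** In the dévissage situation of `ncard_le_sq_of_devissage` over
`K = ℚ`, a set of classes of `H¹(G_ℚ, M)` unramified outside a finite set `S` of primes has at
most `4^{#S+1}` elements (`#ℚ(S, 2) ≤ 2^{#S+1}`, `Rat.natCard_selmerGroup_two_le`). For `M = E[2]`,
`E/ℚ` with a rational `2`-torsion point, and `C = Sel^{(2)}(E/ℚ)`, this is the bound obtained from
Silverman, *AEC*, X.4.9 with Ex. X.4.8 (`#ℚ(S,2) = 2^{#S}` there, `S ∋ ∞`). [cite: SilvermanAEC2009, Prop. X.4.9 (with Lemma X.4.3)] -/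
theorem Rat.ncard_le_four_pow_of_devissage
    {M : Type} [AddCommGroup M] [DistribMulAction (absoluteGaloisGroup ℚ) M]
    [TopologicalSpace M] [DiscreteTopology M]
    {S : Set (HeightOneSpectrum (𝓞 ℚ))} (hS : S.Finite)
    {Q : Type*} [AddCommGroup Q] [TopologicalSpace Q] [DiscreteTopology Q] [Finite Q]
    (hQ : Nat.card Q ≤ 2) (π : M →+ Q) (hπ : ∀ (σ : absoluteGaloisGroup ℚ) (m : M), π (σ • m) = π m)
    (hfix : ∀ m : M, π m = 0 → ∀ σ : absoluteGaloisGroup ℚ, σ • m = m)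
    [Finite π.ker] (hN : Nat.card π.ker ≤ 2)
    (hI : ∀ v ∉ S, ∀ 𝔓 ∈ v.primesAbove, ∀ σ ∈ 𝔓.inertia (absoluteGaloisGroup ℚ),
      ∀ m : M, σ • m = m)
    (C : Set (discreteH1 (absoluteGaloisGroup ℚ) M)) (hC : C ⊆ h1Unramified M S) :
    C.ncard ≤ 4 ^ (Nat.card S + 1) := by
  calc C.ncard ≤ Nat.card (IsDedekindDomain.selmerGroup (R := 𝓞 ℚ) (K := ℚ) (S := S) (n := 2)) ^ 2 :=
        ncard_le_sq_of_devissage hS hQ π hπ hfix hN hI C hC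
    _ ≤ (2 ^ (Nat.card S + 1)) ^ 2 :=
        Nat.pow_le_pow_left (_root_.Rat.natCard_selmerGroup_two_le hS) 2
    _ = 4 ^ (Nat.card S + 1) := by rw [← pow_mul, mul_comm, pow_mul]; norm_num

end Literature.NumberTheory.EllipticCurves

end
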